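import Summits.BirchSwinnertonDyer.BirchSwinnertonDyer.Theorems.ErratumRoadFiveFixedPartOfThm326
import Literature.NumberTheory.EllipticCurves.OrdinaryNewformDatumSelfDualTwist
import HarnessLib

/-!
# The ORDINARY FRAME of `Δ.ρ` on the local Galois group `Γ_{K_𝔭̄}` at a split prime, as a standalone lemma, its determinant
# `χ·δ = ε^{k−1}`, and the self-dual frame as the scalar twist `ε^{1−k/2}` of it
# (helper, `--supports stmt-BirchSwinnertonDyer-23253`)

Cell `bsd-stepL`, seat `bsd-stepL-imc-p1` (prover g25, 2026-08-28). Theorems only (no definition, no named fact, no `sorry`, no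
instance, no notation). First part of the kernel discharge of (FIX)† = stub `stub_finiteFixedPartAnomalous_selfDual` of line
`erratum_chain`† of crux 23253 `ErratumThm23SigmaLeSelfDual` (seat NOTES §FIX†), modulo the named fact [Wiles88 Thm 2.2] =
`Hida2000_thm326_ordinary_unitRoot` exactly as imc-p1 g23's `FixFinal.finiteFixedPartAnomalous_of_thm326` (p653698) for 25505.

* §1 `exists_localOrdinaryFrame_of_thm326` — steps (B1)–(B3) of p653698 PACKAGED: granted [W], for an ordinary newform datum `Δ`,
  `K` quadratic with `p` split and `𝔭̄ ∣ p`, there is `Q' ∈ GL₂(𝒪)` such that `T(τ) := Q'⁻¹ Δ.ρ(res(loc τ)) Q'` (`τ ∈ Γ_{K_𝔭̄}`) is upper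
  triangular, with `T₁₁ = 1` on inertia and `T₁₁(τ)` a root of `X² − ι_g(a_p)X + p^{k−1}` at every arithmetic Frobenius `τ`
  (integral frame `OrdinaryFiltration.exists_integralFrame`, values from [W] through `OrdinaryNewformDatum.frobRoot_of_ordinaryFrame_of_thm326`,
  transport `frame_transport_of_split`).
* §2 `det_localFrame_eq` — `det T(τ) = ε(res(loc τ))^{k−1}` in `𝒪` (Ribet's `prop22_det_eq` over the coefficient field, trivial nebentypus).
* §3 `coe_conj_selfDualRep_eq_smul` — `Q'⁻¹ Δ.selfDualRep(g) Q' = ε^{1−k/2}(g) • Q'⁻¹ Δ.ρ(g) Q'` as matrices; hence the self-dual frame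
  `T†(τ)` is upper triangular with diagonal `(ψχ, ψδ)`, `ψ = ε^{1−k/2}` (`selfDualTwistChar`); the triangular coordinates of
  `A_g^†|Γ_{K_𝔭̄}` then come from `exists_cofree_coordinates_triangular` at `Δ.selfDualRep` (in the final assembly, as in p653698).

HONEST FRAMING: §1–§2 conditional on the named fact [W]; nothing about BSD for any pair; closes: none (T7).

## References
* [Wiles1988] Thm. 2.2; [Hida2000] Thm. 3.26; [Ribet1977] Prop. 2.2; [Castella2018Erratum] §2 (the self-dual Tate twist); [Greenberg1989] §1.
-/

noncomputable section

-- D-0017: single-problem summit, the namespace repeats the problem name by design.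
set_option linter.dupNamespace false
set_option autoImplicit false

open scoped MatrixGroups Matrix ModularForm NumberField
open Filter Topology Field NumberField IsDedekindDomain CongruenceSubgroup UpperHalfPlane
open Literature.NumberTheory.GaloisRepresentations Literature.NumberTheory.GaloisRepresentations.IsNonarchimedeanLocalField
open Literature.NumberTheory.EllipticCurves Literature.NumberTheory.EllipticCurves.ModularForms
open Literature.NumberTheory.EllipticCurves.GreenbergSelmer Literature.NumberTheory.EllipticCurves.BigGaloisRep
open Literature.NumberTheory.EllipticCurves.ZpExtension

namespace Summit.BirchSwinnertonDyer.BirchSwinnertonDyer.Theorems.ErratumThm23TwoVariable.FrameSelfDual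

variable {p : ℕ} [Fact p.Prime] {M : ℕ} [NeZero M] {k : ℤ}
  {g : CuspForm (CongruenceSubgroup.Gamma0 M) k} {ιg : coeffField g →+* PadicAlgCl p}

/-! ## §1 The local ordinary frame of `Δ.ρ` on `Γ_{K_𝔭̄}` from [W] -/

/-- **The ordinary frame of `Δ.ρ` on `Γ_{K_𝔭̄}`, granted [Wiles88 Thm 2.2].** For an ordinary newform datum `Δ` (`g` a newform of weight
`k ≥ 2`, `p ∤ M`, `|ι a_p| = 1`), `K` quadratic with two places above `p` and `𝔭̄ ∋ p`: some `Q' ∈ GL₂(𝒪)` conjugates `Δ.ρ ∘ res ∘ loc`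
into upper triangular form with `(1,1)`-entry `1` on the inertia group and a root of `X² − ι_g(a_p)X + p^{k−1}` at arithmetic Frobenii.
Steps (B1)–(B3) of `FixFinal.finiteFixedPartAnomalous_of_thm326` (p653698), verbatim.
[cite: Wiles1988, Thm. 2.2] [cite: Hida2000, Thm. 3.26 (2)] -/
theorem exists_localOrdinaryFrame_of_thm326 (hW : Hida2000_thm326_ordinary_unitRoot)
    (Δ : OrdinaryNewformDatum g p ιg) (K : Type) [Field K] [NumberField K] (𝔭bar : HeightOneSpectrum (𝓞 K))
    (h1 : IsNewform0 g) (h2 : 2 ≤ k) (h4 : ¬ p ∣ M)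
    (h6 : ‖ιg ⟨(UpperHalfPlane.qExpansion 1 ⇑g).coeff p, coeff_mem_coeffField g p⟩‖ = 1)
    (hK2 : Module.finrank ℚ K = 2) (h8 : ((Ideal.span {(p : ℤ)}).primesOver (𝓞 K)).ncard = 2)
    (h9 : ((p : ℕ) : 𝓞 K) ∈ 𝔭bar.asIdeal) :
    ∃ Q' : GL (Fin 2) (padicCoeffIntegers ιg), ∀ τ : absoluteGaloisGroup (𝔭bar.adicCompletion K),
      (Q'⁻¹ * Δ.ρ (absGaloisRestrict ℚ K (absGaloisRestrict K (𝔭bar.adicCompletion K) τ)) * Q').val 1 0 = 0 ∧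
      (τ ∈ absInertia (𝔭bar.adicCompletion K) →
        (Q'⁻¹ * Δ.ρ (absGaloisRestrict ℚ K (absGaloisRestrict K (𝔭bar.adicCompletion K) τ)) * Q').val 1 1 = 1) ∧
      (IsAbsArithFrob τ →
        (padicCoeffIntegers.toPadicAlgCl ιg)
            ((Q'⁻¹ * Δ.ρ (absGaloisRestrict ℚ K (absGaloisRestrict K (𝔭bar.adicCompletion K) τ)) * Q').val 1 1) ^ 2 -
          ιg ⟨(qExpansion 1 ⇑g).coeff p, coeff_mem_coeffField g p⟩ *
            (padicCoeffIntegers.toPadicAlgCl ιg)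
              ((Q'⁻¹ * Δ.ρ (absGaloisRestrict ℚ K (absGaloisRestrict K (𝔭bar.adicCompletion K) τ)) * Q').val 1 1) +
          (p : PadicAlgCl p) ^ (k - 1) = 0) := by
  classical
  have hp : p.Prime := Fact.out
  haveI : FiniteDimensional ℚ (coeffField g) := IsNewform0.finiteDimensional_coeffField_holds h1
  haveI : FiniteDimensional ℚ_[p] (padicCoeffField ιg) := GreenbergSelmer.finiteDimensional_padicCoeffField ιg
  haveI : IsPrincipalIdealRing (padicCoeffIntegers ιg) := isPrincipalIdealRing_padicCoeffIntegers ιg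
  /- (B1) the other place and the place of `ℚ` below `𝔭bar` -/
  obtain ⟨v, hpv, hne⟩ := FixFinal.exists_other_place h9 h8
  obtain ⟨u, hwu, hu⟩ := exists_heightOneSpectrum_rat_under hp h9
  have hw : (p : 𝓞 ℚ) ∈ u.asIdeal := by
    have h : ((p : ℕ) : 𝓞 ℚ) ∈ 𝔭bar.asIdeal.under (𝓞 ℚ) := by
      rw [Ideal.under_def, Ideal.mem_comap, map_natCast]; exact h9
    rw [hwu] at h
    exact_mod_cast h
  /- (B2) the integral ordinary frame of `Δ.ρ` at `u` and its values -/
  obtain ⟨Q₀, hQ₀⟩ := OrdinaryFiltration.exists_integralFrame Δ.ρ u (Δ.fil u hw)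
  set ρ' := FramedRep.baseChange (padicCoeffIntegers.toPadicAlgCl ιg) continuous_toPadicAlgCl Δ.ρ with hρ'
  set Q₀' : GL (Fin 2) (PadicAlgCl p) := Matrix.GeneralLinearGroup.map (padicCoeffIntegers.toPadicAlgCl ιg) Q₀ with hQ₀'
  have hmapT : ∀ x : absoluteGaloisGroup (u.adicCompletion ℚ),
      Q₀'⁻¹ * FramedGaloisRep.toLocal u ρ' x * Q₀' =
        Matrix.GeneralLinearGroup.map (padicCoeffIntegers.toPadicAlgCl ιg) (Q₀⁻¹ * Δ.ρ.toLocal u x * Q₀) := by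
    intro x
    rw [map_mul, map_mul, map_inv, hQ₀', FramedGaloisRep.toLocal_apply, FramedGaloisRep.toLocal_apply, hρ',
      FramedRep.baseChange_apply]
  have hmapT_val : ∀ (x : absoluteGaloisGroup (u.adicCompletion ℚ)) (i j : Fin 2),
      (Q₀'⁻¹ * FramedGaloisRep.toLocal u ρ' x * Q₀').val i j =
        (padicCoeffIntegers.toPadicAlgCl ιg) ((Q₀⁻¹ * Δ.ρ.toLocal u x * Q₀).val i j) := by
    intro x i j
    rw [hmapT]; rfl
  have hQ₀' : ∀ x : absoluteGaloisGroup (u.adicCompletion ℚ),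
      (Q₀'⁻¹ * FramedGaloisRep.toLocal u ρ' x * Q₀').val 1 0 = 0 ∧
      (x ∈ absInertia (u.adicCompletion ℚ) → (Q₀'⁻¹ * FramedGaloisRep.toLocal u ρ' x * Q₀').val 1 1 = 1) := by
    intro x
    refine ⟨by rw [hmapT_val, (hQ₀ x).1, map_zero], fun hx ↦ by rw [hmapT_val, (hQ₀ x).2 hx, map_one]⟩
  /- (B3) transport to `Γ_{K_𝔭̄}` -/
  exact frame_transport_of_split hK2 hpv h9 hne hwu Δ.ρ Q₀
    (fun T ↦ T.val 1 0 = 0)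
    (fun T ↦ (padicCoeffIntegers.toPadicAlgCl ιg) (T.val 1 1) ^ 2 -
        ιg ⟨(qExpansion 1 ⇑g).coeff p, coeff_mem_coeffField g p⟩ * (padicCoeffIntegers.toPadicAlgCl ιg) (T.val 1 1) +
      (p : PadicAlgCl p) ^ (k - 1) = 0)
    (fun _ T ↦ T.val 1 1 = 1) (fun _ _ _ h ↦ h)
    (fun x ↦ ⟨(hQ₀ x).1, fun hx ↦ (hQ₀ x).2 hx, fun hx ↦ by
      have h := Δ.frobRoot_of_ordinaryFrame_of_thm326 hW h1 h2 h4 h6 hw Q₀' hQ₀' hx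
      rw [hmapT_val] at h
      exact h⟩)

/-! ## §2 The determinant of the frame: `χ δ = ε^{k−1}` -/

/-- **`det(Q⁻¹ Δ.ρ(σ) Q) = ε(σ)^{k−1}` in `𝒪`** (as an element of the coefficient field): Ribet's determinant `det ρ_g = χ·ε^{k−1}`
(`Ribet1977.prop22_det_eq` for the attached representation over `K_𝔭 = padicCoeffField`, `isGaloisRepOfNewform1_baseChange_padicCoeffField`)
with trivial nebentypus on `Γ₀(M)` (`nebentypus_liftToGamma1_holds`), and invariance of `det` under conjugation (`det_val_conj`).
[cite: Ribet1977, Prop. 2.2] [cite: DiamondShurman2005, Thm. 9.6.6 (det ρ_f = χ ε^{k−1})] -/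
theorem det_localFrame_eq (Δ : OrdinaryNewformDatum g p ιg) (h1 : IsNewform0 g) (h2 : 2 ≤ k)
    (Q : GL (Fin 2) (padicCoeffIntegers ιg)) (σ : absoluteGaloisGroup ℚ) {m : ℕ} (hm : ((m : ℕ) : ℤ) = k - 1) :
    (((Q⁻¹ * Δ.ρ σ * Q).val.det : padicCoeffIntegers ιg) : padicCoeffField ιg) =
      algebraMap ℚ_[p] (padicCoeffField ιg) ((GaloisRep.cyclotomicCharacter ℚ p σ : ℤ_[p]ˣ) : ℤ_[p]) ^ m := by
  haveI : FiniteDimensional ℚ (coeffField g) := IsNewform0.finiteDimensional_coeffField_holds h1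
  haveI : FiniteDimensional ℚ_[p] (padicCoeffField ιg) := GreenbergSelmer.finiteDimensional_padicCoeffField ιg
  haveI : IsModuleTopology ℚ_[p] (padicCoeffField ιg) := isModuleTopology_padicCoeffField
  have hg0 := isNewform0_ne_zero h1
  have hε : nebentypus (liftToGamma1 M k g) = 1 := nebentypus_liftToGamma1_holds M k hg0
  have hatt := Δ.isGaloisRepOfNewform1_baseChange_padicCoeffField h1 (by omega : 1 ≤ k)
  have hdetF := Ribet1977.prop22_det_eq hatt hm σ
  have hεc : nebentypusCoeff (liftToGamma1 M k g) (modNCyclotomicCharacter ℚ M σ : ZMod M) = 1 := by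
    apply Subtype.ext
    rw [coe_nebentypusCoeff, hε, MulChar.one_apply (Units.isUnit _)]
    rfl
  rw [hεc, map_one, one_mul, FramedRep.baseChange_apply] at hdetF
  rw [det_val_conj Q (Δ.ρ σ), ← hdetF]
  exact RingHom.map_det (padicCoeffIntegers ιg).subtype (Δ.ρ σ).val

/-! ## §3 The self-dual frame is the scalar twist of the frame -/

omit [NeZero M] in
/-- **`Q⁻¹ T_g^†(σ) Q = ε^{1−k/2}(σ) • Q⁻¹ Δ.ρ(σ) Q` as matrices** (`Δ.selfDualRep σ = scalar(ψ σ)·Δ.ρ σ`, `coe_selfDualRep_apply`,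
and scalars commute with conjugation). [cite: Castella2018Erratum, §2 (p. 2, the self-dual Tate twist)] -/
theorem coe_conj_selfDualRep_eq_smul (Δ : OrdinaryNewformDatum g p ιg) (Q : GL (Fin 2) (padicCoeffIntegers ιg))
    (σ : absoluteGaloisGroup ℚ) :
    ((Q⁻¹ * Δ.selfDualRep σ * Q : GL (Fin 2) (padicCoeffIntegers ιg)) : Matrix (Fin 2) (Fin 2) (padicCoeffIntegers ιg)) =
      ((selfDualTwistChar ιg σ : (padicCoeffIntegers ιg)ˣ) : padicCoeffIntegers ιg) •
        ((Q⁻¹ * Δ.ρ σ * Q : GL (Fin 2) (padicCoeffIntegers ιg)) : Matrix (Fin 2) (Fin 2) (padicCoeffIntegers ιg)) := by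
  rw [Units.val_mul, Units.val_mul, OrdinaryNewformDatum.coe_selfDualRep_apply, Units.val_mul, Units.val_mul,
    Matrix.mul_smul, Matrix.smul_mul]

omit [NeZero M] in
/-- Entrywise form of `coe_conj_selfDualRep_eq_smul`. [cite: Castella2018Erratum, §2 (p. 2)] -/
theorem conj_selfDualRep_val (Δ : OrdinaryNewformDatum g p ιg) (Q : GL (Fin 2) (padicCoeffIntegers ιg))
    (σ : absoluteGaloisGroup ℚ) (i j : Fin 2) :
    (Q⁻¹ * Δ.selfDualRep σ * Q).val i j =
      ((selfDualTwistChar ιg σ : (padicCoeffIntegers ιg)ˣ) : padicCoeffIntegers ιg) * (Q⁻¹ * Δ.ρ σ * Q).val i j := by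
  have h := congrFun (congrFun (coe_conj_selfDualRep_eq_smul Δ Q σ) i) j
  rw [Matrix.smul_apply, smul_eq_mul] at h
  exact h

end Summit.BirchSwinnertonDyer.BirchSwinnertonDyer.Theorems.ErratumThm23TwoVariable.FrameSelfDual

end
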